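import Summits.ResolutionOfSingularities.ResolutionOfSingularities.Theorems.HilbertSamuelEliminationSigmaMaxModificationsCorridor3WLadderIsoTailsHSArc
import Literature.AlgebraicGeometry.Resolution.RsopMonomialIdeals
import Literature.AlgebraicGeometry.Resolution.RegularLocalRingsQuotient
import HarnessLib

/-!
# [OURS · L1 W4.2] D14 ROUTE H — object H7 in regular-system-of-parameters form: the arc `t ↦ (t, 0, …, 0)`

Cell res-hironaka, rung L, slot W4.2 (crux `SigmaMaxModificationsCorridor3`, stmt-ResolutionOfSingularities-19249); row
`stub_Wtop3M_pointed`, KERNEL K1, res-L1-w42-lead-1's D14 BRIDGE CUT, ROUTE H, object H7 (sequel of `…IsoTailsHSArc.lean`).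
The bridge cut produces the arc as `P̂ = (Ŷ₁, Ŷ₂, Ŷ₃)` for a regular system of parameters `(T, Ŷ₁, Ŷ₂, Ŷ₃)` of `R̂`; this file
instantiates H7 in that form: for a regular local ring `R` of dimension `d + 1`, a regular system of parameters `x : Fin (d+1) → R`
(`(x) = 𝔪`) and `P = (x₁, …, x_d)` (`x ∘ Fin.succ`), `P` is prime with `R/P` regular of dimension `1` (the tree's `IsRsopPart` theory,
Matsumura Thm. 14.2), so `…IsoTailsHSArc.not_isIsolatedInHSMaxLocus_closedPoint_of_arc` applies: for `h ∈ P^m`, `h ∉ 𝔪^{m+1}`,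
`m ≥ 1`, the closed point of `Spec (R/(h))` is NOT isolated in the Hilbert–Samuel locus, at every level `N ≥ d`.

[OURS · L1 W4.2] bookkeeping; NOT a statement of any source, and NOT a statement of H. Hironaka's 2017 manuscript. AI-written
(res-type-001 g7); AI review is weaker than expert review.
-/

set_option linter.dupNamespace false

noncomputable section

open CategoryTheory AlgebraicGeometry TopologicalSpace IsLocalRing
open Literature.AlgebraicGeometry.Resolution Literature.RingTheory.HilbertSamuel
open Literature.AlgebraicGeometry.CossartJannsenSaito2020

namespace Summit.ResolutionOfSingularities.ResolutionOfSingularities.Theorems.SigmaMaxModificationsCorridor3.IsoTailsHS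

universe u

/-- **The arc `(x₁, …, x_d)` of a regular system of parameters `(x₀, …, x_d)`**: it is part of a regular system of parameters,
hence a prime with regular quotient of dimension `1`. [cite: Matsumura1987, Thm. 14.2] -/
theorem isPrime_and_isRegularLocalRing_quotient_of_rsop {R : Type u} [CommRing R] [IsRegularLocalRing R] {d : ℕ}
    (hd : ringKrullDim R = (d + 1 : ℕ)) (x : Fin (d + 1) → R) (hx : Ideal.span (Set.range x) = maximalIdeal R) :
    (Ideal.span (Set.range (x ∘ Fin.succ))).IsPrime ∧ IsRegularLocalRing (R ⧸ Ideal.span (Set.range (x ∘ Fin.succ))) ∧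
      ringKrullDim (R ⧸ Ideal.span (Set.range (x ∘ Fin.succ))) = (1 : ℕ) := by
  have hd' : (maximalIdeal R).spanFinrank = d + 1 := by
    have h := IsRegularLocalRing.spanFinrank_maximalIdeal (R := R)
    rw [hd] at h
    exact_mod_cast h
  have hz : IsRsopPart (x ∘ Fin.succ) := isRsopPart_comp_of_rsop hd' x hx Fin.succ (Fin.succ_injective d)
  haveI := hz.isRegularLocalRing_quotient
  refine ⟨hz.isPrime_span_range, hz.isRegularLocalRing_quotient, ?_⟩
  obtain ⟨q, hq⟩ := exists_nat_cast_eq_ringKrullDim (R := R ⧸ Ideal.span (Set.range (x ∘ Fin.succ)))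
  have hsum := hz.ringKrullDim_quotient_add
  rw [hq, hd] at hsum
  have : q + d = d + 1 := by exact_mod_cast hsum
  rw [hq]
  exact_mod_cast (show q = 1 by omega)

/-- **H7 in r.s.p. form (D14 ROUTE H): for a regular local ring `R` of dimension `d + 1` with regular system of parameters
`x = (x₀, …, x_d)`, `h ∈ (x₁, …, x_d)^m` with `h ∉ 𝔪^{m+1}`, `m ≥ 1`, the closed point of `Spec (R/(h))` is NOT isolated in the
Hilbert–Samuel locus** (any level `N ≥ d`): the regular arc `V(x₁, …, x_d)` lies in its stratum
(`not_isIsolatedInHSMaxLocus_closedPoint_of_arc`). At `d = 3`, `x = (T, Ŷ₁, Ŷ₂, Ŷ₃)`, `N = 3` this is row H7 of the bridge cut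
verbatim. [OURS · L1 W4.2; AI-written] -/
theorem not_isIsolatedInHSMaxLocus_closedPoint_of_rsop_arc {R : Type u} [CommRing R] [IsRegularLocalRing R] {d : ℕ}
    (hd : ringKrullDim R = (d + 1 : ℕ)) (x : Fin (d + 1) → R) (hx : Ideal.span (Set.range x) = maximalIdeal R)
    {m : ℕ} (hm : 1 ≤ m) {h : R} (hhP : h ∈ Ideal.span (Set.range (x ∘ Fin.succ)) ^ m)
    (hh : h ∉ maximalIdeal R ^ (m + 1)) [IsLocalRing (R ⧸ Ideal.span {h})] {N : ℕ} (hN : d ≤ N) :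
    ¬ IsIsolatedInHSMaxLocus (Spec (CommRingCat.of (R ⧸ Ideal.span {h}))) N (closedPoint (R ⧸ Ideal.span {h})) := by
  obtain ⟨hP, hreg, hP1⟩ := isPrime_and_isRegularLocalRing_quotient_of_rsop hd x hx
  haveI := hP
  haveI := hreg
  exact not_isIsolatedInHSMaxLocus_closedPoint_of_arc hd (Ideal.span (Set.range (x ∘ Fin.succ))) hP1 hm hhP hh hN

/-- The r.s.p. form of the RING-LEVEL statement: `ord_{R_P} h = m` and `H^{(1)}((R/(h))_P̄) = H^{(0)}(R/(h)) = hypersurfaceHFe (d+1) m`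
for the arc `P = (x₁, …, x_d)`. [OURS · L1 W4.2; AI-written] -/
theorem hilbertSamuelFun_one_localization_eq_hilbertFun_of_rsop {R : Type u} [CommRing R] [IsRegularLocalRing R] {d : ℕ}
    (hd : ringKrullDim R = (d + 1 : ℕ)) (x : Fin (d + 1) → R) (hx : Ideal.span (Set.range x) = maximalIdeal R)
    {m : ℕ} (hm : 1 ≤ m) {h : R} (hhP : h ∈ Ideal.span (Set.range (x ∘ Fin.succ)) ^ m)
    (hh : h ∉ maximalIdeal R ^ (m + 1)) [(Ideal.span (Set.range (x ∘ Fin.succ))).IsPrime]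
    [(Ideal.map (Ideal.Quotient.mk (Ideal.span {h})) (Ideal.span (Set.range (x ∘ Fin.succ)))).IsPrime]
    [IsLocalRing (R ⧸ Ideal.span {h})]
    (Ap : Type u) [CommRing Ap] [Algebra (R ⧸ Ideal.span {h}) Ap]
    [IsLocalization.AtPrime Ap (Ideal.map (Ideal.Quotient.mk (Ideal.span {h})) (Ideal.span (Set.range (x ∘ Fin.succ))))]
    [IsLocalRing Ap] :
    hilbertSamuelFun Ap 1 = hilbertFun (R ⧸ Ideal.span {h}) ∧
      hilbertFun (R ⧸ Ideal.span {h}) = Helpers.hypersurfaceHFe (d + 1) m ∧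
      algebraMap R (Localization (Ideal.span (Set.range (x ∘ Fin.succ))).primeCompl) h ∈
        maximalIdeal (Localization (Ideal.span (Set.range (x ∘ Fin.succ))).primeCompl) ^ m ∧
      algebraMap R (Localization (Ideal.span (Set.range (x ∘ Fin.succ))).primeCompl) h ∉
        maximalIdeal (Localization (Ideal.span (Set.range (x ∘ Fin.succ))).primeCompl) ^ (m + 1) := by
  obtain ⟨-, hreg, hP1⟩ := isPrime_and_isRegularLocalRing_quotient_of_rsop hd x hx
  haveI := hreg
  exact hilbertSamuelFun_one_localization_eq_hilbertFun hd (Ideal.span (Set.range (x ∘ Fin.succ))) hP1 hm hhP hh Ap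

end Summit.ResolutionOfSingularities.ResolutionOfSingularities.Theorems.SigmaMaxModificationsCorridor3.IsoTailsHS

end
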